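import Summits.BirchSwinnertonDyer.Rank1Residual.AdditivePotMult.PotMultRankOneKatoCertificate
import Summits.BirchSwinnertonDyer.Rank1Residual.Additive.GordRankOneKatoCertificateBSD
import Summits.BirchSwinnertonDyer.Rank1Residual.AdditivePotMult.CycRankOneLambdaClass
import Summits.BirchSwinnertonDyer.Rank1Residual.Additive.X3BranchLambda
import HarnessLib

/-!
# X3♯(M) in analytic rank ONE at EVERY odd `p` (`p = 3` included): Wuthrich's divisibility on the
# `ω^{(p−1)/2}`-branch of the `p`-MULTIPLICATIVE twist `E♭` (`E[p]` REDUCIBLE) + seat p07's ONE-NUMBER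
# `MultBranchUnitCertificateAt` ⟹ `μ = 0 ∧ λ ≤ 1`; with Delbourgo 2002 (M): Schneider PROVED,
# `#Ш[p^∞] < ∞`, the exact identity, and `BSD(E,p) ⟺ ord_p q + ord_p Reg_p(E,Dh) = 1`
# (cell `b2b-bsdres`, team n1011, seat p12 (gen 2), OWNERS row T-O7KM-X3 — the X3 twin of seat p07's
# `PotMultRankOneKatoCertificate.lean`, T-O7KM, offered in `cells/n1011/skel/T-O7KM.md` §5)

HONEST FRAMING (cell `b2b-bsdres`, run/shared/lean/b2b/bsd-rank1-residual/, verbatim in every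
file): the goal of the cell is to DELETE the COMBINATION-SHAPED residual classes of the
Birch–Swinnerton-Dyer formula for ALL analytic-rank `≤ 1` elliptic curves over `ℚ` — "full BSD
formula for every rank `≤ 1` curve in class `C`" assembled STRICTLY from published theorems — so
that the rank-`≤ 1` remainder becomes exactly the CONSTRUCTION-SHAPED classes, which are TYPED
(missing-input `Prop`s), NOT attempted. This is not "finishing BSD". Team n1011 (RESIDUAL-MAP §I
O7, the (M) share with REDUCIBLE `E[p]` = X3♯(M) ∧ `r_an = 1`), seat `b2b-bsdres-n1011-p12` (gen 2):
research route on the CONSTRUCTION-SHAPED classes X3 / O7; labels and marks UNCHANGED; nothing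
booked; NO Literature fact minted; NO definition (seat p07's `MultBranchUnitCertificateAt` BY NAME).
THEOREMS ONLY; named facts are explicit HYPOTHESES: `hW16` =
`Wuthrich2014.thm16_halfEigenCharIdeal_dvd_cyclotomicPrime` (Wuthrich, Doc. Math. 19 (2014) Thm. 16
on the `ω^{(p−1)/2}`-eigencomponent of a SEMISTABLE `V` with REDUCIBLE `V[p]`, full-series
conclusion `ι g = C(u·ϖ)·B`; its reduction disjunction carries the two MULTIPLICATIVE branches),
`hDelM` = `Delbourgo2002.mainTheorem_potMult` (A190, `p ≠ 2`), `hGZK`, `hmod`, `hmodD`.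

## What and why

Seat p07 (`PotMultRankOneKatoCertificate.lean`, T-O7KM) proved on X4(M) ∧ {`ρ̄_{E,p}` onto}, every odd
`p`: Kato's divisibility on the multiplicative-twist branch + the ONE-NUMBER certificate
`MultBranchUnitCertificateAt W p` ⟹ `X` torsion, `μ(fE) = 0`, `λ(fE) ≤ 1` for every generator `fE` of
`char_Λ X(E/ℚ_∞)`; the image hypothesis enters ONLY through Kato's fact and the tower of `E♭`. On
X3♯(M) (`E[p]` REDUCIBLE, hence `E♭[p]` reducible — additive-p1's `irr_iff_of_model_twist`) the
published half is Wuthrich's Thm. 16 instead, which needs NO image / tower hypothesis; Delbourgo 2002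
(M) has no image hypothesis either (`ClassX3M.delbourgo2002`: no CM and non-anomalous are AUTOMATIC
on (M), `PotMult.not_hasCM`, `PotMult.reductionNonAnomalous` — so `ℓ = 1`). Hence the whole chain
runs on X3♯(M) with STRICTLY FEWER binders than on X4(M):

* §1 `isTorsion_and_exists_iota_eq_of_wuthrichHalf` — the full-series brick (the tree's
  `isTorsion_and_exists_map_eq_of_halfTail` with `htail := hW16`), for a twist model with `V[p]`
  reducible; no tower.
* §2 `ClassX3M.isTorsion_and_mu_zero_lam_le_one_of_wuthrichHalf_of_multCert`,
  `ClassX3M.charLamLeAt_one_of_wuthrichHalf_of_multCert` — EVERY odd `p`: `hW16` ∧ `hmodD` ∧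
  `ClassX3M W p` ∧ `MultBranchUnitCertificateAt W p` ⟹ torsion, `μ = 0`, `λ ≤ 1` (p07's proof with
  the tower line replaced by reducibility).
* §3 with A190 (`hDelM`) and `r_an = 1` (GZK): Schneider's `Reg_p(E,Dh) ≠ 0` PROVED for every
  (B)-datum and the exact identity `ord_p #Ш(E) + ord_p Reg_p(E,Dh) + ord_p ∏c_ℓ = 1 + 2·ord_p #E(ℚ)_tors`
  (NO `ℓ`) — `ClassX3M.schneider_and_padicVal_identity_rankOne_of_wuthrichHalf_of_multCert`
  (additive-p2's cell-agnostic `schneider_and_padicVal_identity_rankOne_of_mu_zero_lam_le_one`); the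
  (B)-datum SUPPLIED (`…exists_leadingTermClauses_and_schneider…`); `#Ш(E)[p^∞] < ∞` WITHOUT GZK at
  any rank-`1` Mordell–Weil group (`…finite_shaPrimary…`, `PotMult.finite_shaPrimary_of_charLamLe`).
* §4 `ClassX3M.bsdp_iff_padicVal_rankOne_of_wuthrichHalf_of_multCert`: **`BSD(E,p) ⟺ ord_p q +
  ord_p Reg_p(E,Dh) = 1`** (`L'(E,1) = q·Ω_E·Reg_∞(E)`; additive-p2's `bsdp_iff_padicValRat_add_eq_one`)
  — on X3♯(M) ∧ `r_an = 1` certificate rows at EVERY odd `p` the residue of `BSD(E,p)` is ONE `p`-adic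
  valuation; and the LOWER half from one regulator valuation
  (`ClassX3M.missingLowerBoundAt_rankOne_of_wuthrichHalf_of_multCert_of_regulatorCertificate`).

Binders (nothing silently dropped): {`hW16`, `hmodD`, `hGZK`/`hmod` (§3–§4), `hDelM` (supply forms),
`ClassX3M W p` (carries `p ≠ 2` and `¬ Irr W p`), `r_an = 1`, `MultBranchUnitCertificateAt W p`
(per-pair numerics, EVIDENCE), `Dh`/`hB`, `q`/`hLq`} — NO `Surj`, NO tower, NO `5 ≤ p`, NO `¬CM`, NO
`ReductionNonAnomalous`, NO `hL20`, NO `hPal`. Nothing booked; X3 / O7 stay CONSTRUCTION-SHAPED.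

References: C. Wuthrich, Doc. Math. 19 (2014) Thm. 16, §3 [Wuthrich2014]; D. Delbourgo, J. Number
Theory 95 (2002) Thm. (A), (B) [Delbourgo2002]; B. Mazur, J. Tate, J. Teitelbaum, Invent. Math. 84
(1986) §I.10, §I.13–I.14 [MazurTateTeitelbaum1986Invent]; L. Washington, GTM 83 §7.1 [Washington1997];
R. L. Miller, LMS JCM 14 (2011) Def. 1.1 [Miller2011LMS]; W. Stein, C. Wuthrich, Math. Comp. 82 (2013)
§4 [SteinWuthrich2013].
-/

noncomputable section

open scoped Classical MatrixGroups ModularForm NumberField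

namespace Summit.BirchSwinnertonDyer.Rank1Residual.AdditivePotMult

open CongruenceSubgroup WeierstrassCurve NumberField Literature.NumberTheory.EllipticCurves
  Literature.NumberTheory.EllipticCurves.ModularForms
  Literature.NumberTheory.EllipticCurves.Rank1Residual
  Literature.NumberTheory.EllipticCurves.Rank1Residual.Typed
  Literature.NumberTheory.EllipticCurves.Delbourgo2002
  Literature.NumberTheory.GaloisRepresentations
  Summit.BirchSwinnertonDyer.Rank1Residual.Additive
  Summit.BirchSwinnertonDyer.Rank1Residual.X1.MuLambda
  Summit.BirchSwinnertonDyer.Rank1Residual.X1.RankOneParitySqueeze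
  IsDedekindDomain

/-! ### §1 The full-series brick on (M) with REDUCIBLE `E♭[p]`, from Wuthrich's half-eigen divisibility -/

section Brick

variable {W : WeierstrassCurve ℚ} [W.IsElliptic] {p : ℕ} [hp : Fact p.Prime]

/-- **Full-series brick, REDUCIBLE `V[p]`, EVERY odd `p`.** For a twist model `C • V^{(p*)} = W` with
`V[p]` reducible, a cyclotomic `κ/γ` matching the cyclotomic variable, the newform `f` of `V`, a
branch series `B` in the reduction disjunction (on (M): the MULTIPLICATIVE branches, `a_p = ±1`), the
period ratio `ϖ` of the parity of `(p−1)/2`, and EVERY `Λ`-dual datum `D` of `Sel_{p^∞}(W/ℚ_∞)`: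
`X(W/ℚ_∞)` is torsion and SOME `g ∈ char_Λ X(W/ℚ_∞)` has `ι g = C(u·ϖ)·B`, `u ∈ ℤ_p^×` — from
Wuthrich 2014 Thm. 16 (`hW16`) via the tree's full-series core `isTorsion_and_exists_map_eq_of_halfTail`.
NO image / tower hypothesis. [cite: Wuthrich2014, Thm. 16 (p. 397), §3 (p. 390)]
[cite: GreenbergLNM1716, §5 (PDF p. 143)] -/
theorem isTorsion_and_exists_iota_eq_of_wuthrichHalf
    (hW16 : Wuthrich2014.thm16_halfEigenCharIdeal_dvd_cyclotomicPrime) (hp2 : p ≠ 2)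
    (V : WeierstrassCurve ℚ) [V.IsElliptic] [V.IsGloballyMinimal] (C : VariableChange ℚ)
    (hC : C • V.quadraticTwist ((-1 : ℚ) ^ (p / 2) * p) = W) (hirrV : ¬ V.HasIrreducibleModPGaloisRep p)
    {κ : ZpExtension ℚ p} {γ : Field.absoluteGaloisGroup ℚ}
    (hκ : κ.IsCyclotomic) (hγ : κ.IsTopGenerator γ) (hcv : IsCyclotomicVariable p γ)
    {N : ℕ} [NeZero N] {f : CuspForm (Gamma0 N) 2} (hf : IsNewformOf V f)
    (D : W.SelmerDualData κ γ) (B : PowerSeries ℚ_[p])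
    (hdisj : (IsOrdinaryAt V p ∧
        B = if Even (p / 2) then padicLFunctionBranch f ((unitRoot V p : ℤ_[p]) : ℚ_[p]) (p / 2)
          else padicLFunctionMinusBranch f ((unitRoot V p : ℤ_[p]) : ℚ_[p]) (p / 2)) ∨
      (V.HasSplitMultiplicativeReductionAtPrime p ∧
        B = if Even (p / 2) then padicLFunctionPlusBranchMult f (1 : ℚ_[p]) (p / 2)
          else padicLFunctionMinusBranchMult f (1 : ℚ_[p]) (p / 2)) ∨
      (V.HasMultiplicativeReductionAtPrime p ∧ ¬ V.HasSplitMultiplicativeReductionAtPrime p ∧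
        B = if Even (p / 2) then padicLFunctionPlusBranchMult f (-1 : ℚ_[p]) (p / 2)
          else padicLFunctionMinusBranchMult f (-1 : ℚ_[p]) (p / 2)))
    (ϖ : ℚ) (hϖ : if Even (p / 2) then (ϖ : ℝ) * V.realPeriodRat = plusPeriod f
      else (ϖ : ℝ) * V.imaginaryPeriodRat = minusPeriod f) :
    D.IsTorsion ∧ ∃ g ∈ D.charIdeal, ∃ u : ℤ_[p]ˣ,
      iwasawaToPowerSeries p g = PowerSeries.C (((u : ℤ_[p]) : ℚ_[p]) * (ϖ : ℚ_[p])) * B := by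
  haveI : (V.quadraticTwist ((-1 : ℚ) ^ (p / 2) * p)).IsElliptic :=
    isElliptic_quadraticTwist V (pStar_ne_zero p)
  refine isTorsion_and_exists_map_eq_of_halfTail hC hp2 (not_sq_eq_pStar p) rfl hκ hγ hcv D ?_
  intro K _ _ _ F _ _ _ _ γ' h2 hθ hγ' hcyc' hγ'K hγ'F D'
  exact hW16 p V K F B hp2 h2 hθ hdisj hirrV hκ hγ' hcyc' hγ'K hγ'F hf D' ϖ hϖ

end Brick

/-! ### §2 Class level, EVERY odd `p`: the certificate DISCHARGES `λ ≤ 1` and `μ = 0` on X3♯(M) -/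

section ClassLevel

variable {W : WeierstrassCurve ℚ} [W.IsElliptic] [W.IsGloballyMinimal] {p : ℕ} [hp : Fact p.Prime]

/-- **X3♯(M), EVERY odd `p` (`p = 3` included): Wuthrich's divisibility + the one-number certificate
⟹ for EVERY cyclotomic dual datum and EVERY generator `fE` of `char_Λ X(E/ℚ_∞)`: `X` is torsion,
`μ(fE) = 0` and `λ(fE) ≤ 1`.** Seat p07's X4(M) proof with the tower line replaced by reducibility
(`E[p]` reducible is part of `ClassX3M`; `E♭[p]` reducible by `irr_iff_of_model_twist`): twist model
`ClassX3M.exists_mult_pStar_twist_model`, parametrisation datum, period ratio, `a_p(f) = ±1` by the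
split / non-split dichotomy, §1, additive-p2's `Λ`-algebra `mu_eq_zero_and_lam_le_one_of_iota_eq`.
NO image, NO tower, NO Delbourgo, NO height, NO GZK here. [cite: Wuthrich2014, Thm. 16 (p. 397)]
[cite: Washington1997, §7.1] -/
theorem ClassX3M.isTorsion_and_mu_zero_lam_le_one_of_wuthrichHalf_of_multCert
    (hW16 : Wuthrich2014.thm16_halfEigenCharIdeal_dvd_cyclotomicPrime)
    (hmodD : nonempty_modularParametrizationData)
    (hX : ClassX3M W p) (hcert : MultBranchUnitCertificateAt W p)
    {κ : ZpExtension ℚ p} {γ : Field.absoluteGaloisGroup ℚ}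
    (hκ : κ.IsCyclotomic) (hγ : κ.IsTopGenerator γ) (hγ' : IsCyclotomicVariable p γ)
    (D : W.SelmerDualData κ γ) {fE : IwasawaAlgebra p} (hchar : D.charIdeal = Ideal.span {fE}) :
    D.IsTorsion ∧ mu fE = 0 ∧ lam fE ≤ 1 := by
  have hp2 : p ≠ 2 := hX.p_ne_two
  obtain ⟨V, iV, iVm, C, hV, hC⟩ := hX.exists_mult_pStar_twist_model
  haveI : NeZero (V.conductorNorm ℤ) := ⟨(V.conductorNorm_pos_holds).ne'⟩
  obtain ⟨Dm⟩ := hmodD V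
  obtain ⟨ϖ, hϖ⟩ := exists_periodRatio_parity (p := p) V Dm
  -- `V[p]` is reducible with `W[p]`
  have hirrV : ¬ V.HasIrreducibleModPGaloisRep p := fun hVirr ↦
    hX.classX3.1 ((irr_iff_of_model_twist (W := V) (p := p) (pStar_ne_zero p) ⟨C, hC⟩).mpr hVirr)
  -- the branch series of `V`'s reduction type: `a_p = 1` (split) or `a_p = −1` (non-split)
  by_cases hs : V.HasSplitMultiplicativeReductionAtPrime p
  · obtain ⟨hap, -⟩ := Dm.isNewformOf.cuspCoeff_eq_one_and_sq_of_split hs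
    obtain ⟨h0, h1⟩ := hcert V C hV hC Dm.f Dm.isNewformOf 1 (by exact_mod_cast hap) ϖ hϖ
    rw [Int.cast_one] at h0 h1
    obtain ⟨hXt, g, hg, u, hι⟩ := isTorsion_and_exists_iota_eq_of_wuthrichHalf hW16 hp2 V C hC hirrV hκ
      hγ hγ' Dm.isNewformOf D _ (Or.inr (Or.inl ⟨hs, rfl⟩)) ϖ hϖ
    exact ⟨hXt, mu_eq_zero_and_lam_le_one_of_iota_eq D hchar hg hι h0 h1⟩
  · obtain ⟨hap, -⟩ := Dm.isNewformOf.cuspCoeff_eq_neg_one_and_dvd_of_nonsplit hV hs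
    obtain ⟨h0, h1⟩ := hcert V C hV hC Dm.f Dm.isNewformOf (-1) (by exact_mod_cast hap) ϖ hϖ
    rw [Int.cast_neg, Int.cast_one] at h0 h1
    obtain ⟨hXt, g, hg, u, hι⟩ := isTorsion_and_exists_iota_eq_of_wuthrichHalf hW16 hp2 V C hC hirrV hκ
      hγ hγ' Dm.isNewformOf D _ (Or.inr (Or.inr ⟨hV, hs, rfl⟩)) ϖ hϖ
    exact ⟨hXt, mu_eq_zero_and_lam_le_one_of_iota_eq D hchar hg hι h0 h1⟩

/-- Hence n1011-p01's typed λ-input **`CharLamLeAt W p 1` HOLDS on X3♯(M), EVERY odd `p`, given the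
certificate.** [cite: Wuthrich2014, Thm. 16 (p. 397)] -/
theorem ClassX3M.charLamLeAt_one_of_wuthrichHalf_of_multCert
    (hW16 : Wuthrich2014.thm16_halfEigenCharIdeal_dvd_cyclotomicPrime)
    (hmodD : nonempty_modularParametrizationData)
    (hX : ClassX3M W p) (hcert : MultBranchUnitCertificateAt W p) : CharLamLeAt W p 1 :=
  fun _ _ hκ hγ hγ' D _ hchar ↦
    (hX.isTorsion_and_mu_zero_lam_le_one_of_wuthrichHalf_of_multCert hW16 hmodD hcert hκ hγ hγ' D
      hchar).2.2

end ClassLevel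

/-! ### §3 Rank ONE with Delbourgo 2002 (M): Schneider PROVED and the exact identity (no `ℓ`) -/

section RankOne

variable {W : WeierstrassCurve ℚ} [W.IsElliptic] [W.IsGloballyMinimal] {p : ℕ} [hp : Fact p.Prime]

/-- **X3♯(M), `r_an = 1`, EVERY odd `p`: for EVERY height datum `Dh` with Delbourgo's (B)-clauses —
in particular Delbourgo's `⟨,⟩_{p,ℚ}` — the certificate gives Schneider's `Reg_p(E,Dh) ≠ 0` (PROVED)
and the EXACT identity `ord_p #Ш(E) + ord_p Reg_p(E,Dh) + ord_p ∏c_ℓ = 1 + 2·ord_p #E(ℚ)_tors`** —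
NO `ℓ`: Delbourgo's anomalous proviso is VACUOUS on (M) (`PotMult.reductionNonAnomalous`). Inputs:
`hW16`, `hmodD`, GZK (`rank = 1`, `Ш` finite), additive-p2's cell-agnostic core
`schneider_and_padicVal_identity_rankOne_of_mu_zero_lam_le_one` over §2.
[cite: Delbourgo2002, Theorem (B) (p. 40), ℓ_p(E) = 1 (p. 39)] [cite: Wuthrich2014, Thm. 16 (p. 397)] -/
theorem ClassX3M.schneider_and_padicVal_identity_rankOne_of_wuthrichHalf_of_multCert
    (hW16 : Wuthrich2014.thm16_halfEigenCharIdeal_dvd_cyclotomicPrime)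
    (hmodD : nonempty_modularParametrizationData)
    (hGZK : rank_eq_analyticRank_of_analyticRank_le_one)
    (hX : ClassX3M W p) (hr : W.analyticRank = 1) (hcert : MultBranchUnitCertificateAt W p)
    {Dh : PAdicHeightData W p} (hB : LeadingTermClauses W p Dh) :
    SchneiderConjecture Dh ∧
      (padicValNat p W.shaOrder : ℤ) + (padicRegulator Dh).valuation + padicValNat p W.tamagawaProduct =
        1 + 2 * padicValNat p W.torsionOrder := by
  obtain ⟨hmw, hfinSha⟩ := hGZK W (by rw [hr])
  have hr1 : W.mordellWeilRank = 1 := by rw [hmw, hr]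
  haveI : Finite W.sha := hfinSha
  obtain ⟨hS, -, ℓ, -, hℓ1, hid⟩ :=
    schneider_and_padicVal_identity_rankOne_of_mu_zero_lam_le_one (W := W) (p := p) hX.p_ne_two hr1 hB
      fun κ γ hκ hγ hγ' D fE hchar ↦
        hX.isTorsion_and_mu_zero_lam_le_one_of_wuthrichHalf_of_multCert hW16 hmodD hcert hκ hγ hγ' D hchar
  refine ⟨hS, ?_⟩
  rw [hℓ1 hX.potMult.reductionNonAnomalous, padicValNat_one_right, Nat.cast_zero, add_zero,
    padicValNat_card_addPrimaryComponent] at hid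
  exact hid

/-- **The (B)-datum SUPPLIED by Delbourgo 2002 (M)** (`hDelM`; no CM and the twist witness are
AUTOMATIC on X3♯(M), `ClassX3M.delbourgo2002`): on X3♯(M) ∧ `r_an = 1` there IS a height datum with
the (B)-clauses, and it is non-degenerate. [cite: Delbourgo2002, Theorem (A), (B) (p. 40)] -/
theorem ClassX3M.exists_leadingTermClauses_and_schneider_of_wuthrichHalf_of_multCert
    (hDelM : Delbourgo2002.mainTheorem_potMult)
    (hW16 : Wuthrich2014.thm16_halfEigenCharIdeal_dvd_cyclotomicPrime)
    (hmodD : nonempty_modularParametrizationData)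
    (hGZK : rank_eq_analyticRank_of_analyticRank_le_one)
    (hX : ClassX3M W p) (hr : W.analyticRank = 1) (hcert : MultBranchUnitCertificateAt W p) :
    ∃ Dh : PAdicHeightData W p, LeadingTermClauses W p Dh ∧ SchneiderConjecture Dh := by
  obtain ⟨-, Dh, hB⟩ := hX.delbourgo2002 hDelM
  exact ⟨Dh, hB, (hX.schneider_and_padicVal_identity_rankOne_of_wuthrichHalf_of_multCert hW16 hmodD
    hGZK hr hcert hB).1⟩

/-- **X3♯(M), EVERY odd `p`, `rank E(ℚ) = 1` (no Gross–Zagier–Kolyvagin): `#Ш(E)[p^∞] < ∞`** from the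
certificate — Delbourgo 2002 (M) supplies a (B)-datum and clause 2 applies at `ord_T fE = 1`
(`PotMult.finite_shaPrimary_of_charLamLe`). [cite: Delbourgo2002, Theorem (A), (B) (p. 40)] -/
theorem ClassX3M.finite_shaPrimary_of_wuthrichHalf_of_multCert
    (hDelM : Delbourgo2002.mainTheorem_potMult)
    (hW16 : Wuthrich2014.thm16_halfEigenCharIdeal_dvd_cyclotomicPrime)
    (hmodD : nonempty_modularParametrizationData)
    (hX : ClassX3M W p) (hr1 : W.mordellWeilRank = 1) (hcert : MultBranchUnitCertificateAt W p) :
    Finite (AddCommGroup.primaryComponent W.sha p) :=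
  hX.potMult.finite_shaPrimary_of_charLamLe hDelM hX.p_ne_two
    (by rw [hr1]; exact hX.charLamLeAt_one_of_wuthrichHalf_of_multCert hW16 hmodD hcert)

end RankOne

/-! ### §4 `BSD(E,p)` ⟺ ONE valuation; the LOWER half from one regulator valuation -/

section BSD

variable {W : WeierstrassCurve ℚ} [W.IsElliptic] [W.IsGloballyMinimal] {p : ℕ} [hp : Fact p.Prime]

/-- **X3♯(M), `r_an = 1`, EVERY odd `p`: `BSD(E,p) ⟺ ord_p q + ord_p Reg_p(E,Dh) = 1`** for every
(B)-datum `Dh`, where `L'(E,1) = q·Ω_E·Reg_∞(E)` — given Wuthrich's divisibility and the one-number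
certificate; `Ш` has left the statement (additive-p2's bookkeeping `bsdp_iff_padicValRat_add_eq_one`).
On X3♯(M) certificate rows the residue of `BSD(E,p)` is ONE `p`-adic valuation (O7's Disegni–Delbourgo
comparison as one integer per pair). NO image / tower / `5 ≤ p` / CM / anomalous / Pal binder.
[cite: Delbourgo2002, Theorem (B) (p. 40)] [cite: Wuthrich2014, Thm. 16 (p. 397)] [cite: Miller2011LMS, Def. 1.1] -/
theorem ClassX3M.bsdp_iff_padicVal_rankOne_of_wuthrichHalf_of_multCert
    (hW16 : Wuthrich2014.thm16_halfEigenCharIdeal_dvd_cyclotomicPrime)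
    (hmodD : nonempty_modularParametrizationData)
    (hGZK : rank_eq_analyticRank_of_analyticRank_le_one) (hmod : hasEntireLFunction_rat)
    (hX : ClassX3M W p) (hr : W.analyticRank = 1) (hcert : MultBranchUnitCertificateAt W p)
    {Dh : PAdicHeightData W p} (hB : LeadingTermClauses W p Dh)
    {q : ℚ} (hLq : W.leadingLCoeff = (q : ℂ) * (W.realPeriodRat : ℂ) * (W.regulator : ℂ)) :
    BSDp W p ↔ padicValRat p q + (padicRegulator Dh).valuation = 1 := by
  obtain ⟨-, hid⟩ :=
    hX.schneider_and_padicVal_identity_rankOne_of_wuthrichHalf_of_multCert hW16 hmodD hGZK hr hcert hB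
  have hq0 : q ≠ 0 := by
    rintro rfl
    rw [Rat.cast_zero, zero_mul, zero_mul] at hLq
    exact W.leadingLCoeff_ne_zero_holds (hmod W) hLq
  exact bsdp_iff_padicValRat_add_eq_one (W := W) (p := p) hGZK (by rw [hr]) hq0 hLq hid

/-- **X3♯(M), `r_an = 1`, EVERY odd `p`: `Typed.MissingLowerBoundAt W p` from the branch-unit
certificate and ONE regulator-valuation certificate** (`ord_p Reg_p(Dh) + ord_p #Ш_an + ord_p ∏c ≤
1 + 2·ord_p #tors` for the (B)-data; `ClassX3M.missingLowerBoundAt_of_charLamLe_of_regulatorCertificate`).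
[cite: Delbourgo2002, Theorem (A), (B) (p. 40)] [cite: Miller2011LMS, Def. 1.1] -/
theorem ClassX3M.missingLowerBoundAt_rankOne_of_wuthrichHalf_of_multCert_of_regulatorCertificate
    (hDelM : Delbourgo2002.mainTheorem_potMult)
    (hW16 : Wuthrich2014.thm16_halfEigenCharIdeal_dvd_cyclotomicPrime)
    (hmodD : nonempty_modularParametrizationData)
    (hGZK : rank_eq_analyticRank_of_analyticRank_le_one)
    (hX : ClassX3M W p) (hr : W.analyticRank = 1) (hcert : MultBranchUnitCertificateAt W p)
    {s : ℚ} (hs : shaAn W = (s : ℂ))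
    (hreg : ∀ Dh : PAdicHeightData W p, LeadingTermClauses W p Dh →
      (padicRegulator Dh).valuation + padicValRat p s + padicValNat p W.tamagawaProduct ≤
        (W.mordellWeilRank : ℤ) + 2 * padicValNat p W.torsionOrder) :
    MissingLowerBoundAt W p := by
  have hlam : CharLamLeAt W p W.mordellWeilRank := by
    rw [(hGZK W hr.le).1.trans hr]
    exact hX.charLamLeAt_one_of_wuthrichHalf_of_multCert hW16 hmodD hcert
  exact hX.missingLowerBoundAt_of_charLamLe_of_regulatorCertificate hDelM hGZK hr.le hlam hs hreg

end BSD

end Summit.BirchSwinnertonDyer.Rank1Residual.AdditivePotMult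

end
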